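import Summits.BirchSwinnertonDyer.Rank1Residual.Additive.RamifiedSevenGenusCyclotomicTowerHyps
import Literature.NumberTheory.IwasawaTheory.CyclotomicSemilocalUnitDataConstruction
import HarnessLib

set_option autoImplicit false

/-!
# `𝒞₇` genus road (crux `EllipticUnitValueSevenOfGZK`, K7r), file (6): **`genusFrameOf`** — the `𝒞₇` genus frame
# `GenusSeven.GenusFrame` CONSTRUCTED from the road data `(D, N)` modulo the Kubota–Leopoldt existence fact `hKL`,
# its semi-local datum `U` being Tsuji's `𝓤 = lim← 𝓤_{K_n}` from row K2C-13 (`cyclotomicSemilocalUnitData`) at the socket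

Cell bsd-cm, seat bsd-cm-k-ty1 g33 (literature-prover, typer); pen rulings D1059/D1060 (file (6) = `genusFrameOf`,
«blocked only on K2C-13»), D1093 (remaining typing rows), D1094 (O3), D1099/D1100 (the socket line of record); junction
memo `Cruxes/EllipticUnitValueSevenOfGZK/K2C13InterfaceReading_g77.md` §4 («the one line of file (6)»).

WHAT.  `GenusSeven.GenusFrame` (`RamifiedSevenGenusFactorisationShape.lean` :100–157) is the HYPOTHESIS STRUCTURE of
Tsuji's binders at `(p, m, f, φ, i) = (7, |D|, |D|, χ_D, 5)` over the road data `(D, N𝔞)`.  Row K2C-14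
(`RamifiedSevenGenusFrameArithmeticInputs{,Eta}.lean`) filled every arithmetic field by a closed term and certified the
assembly `ArithmeticInputs.mkGenusFrame D hD hD4 hsq h7 N hN hNc hKL U` with the semi-local datum `U` as an ARGUMENT;
row K2C-13 (`Literature/NumberTheory/IwasawaTheory/CyclotomicSemilocalUnitData{Families,Representatives,Construction}.lean`,
port of bsd-idea-20 g83's draft of record) CONSTRUCTED Tsuji's `𝓤` as `cyclotomicSemilocalUnitData p v L hL Υ γ₀ H`
from bundled tower hypotheses `H : SemilocalUnitTower.Hyps …`; and `RamifiedSevenGenusCyclotomicTowerHyps.lean`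
discharged the seven fields of `H` at K2C-14's closed terms.  This file writes the ONE LINE joining them:

* `ArithmeticInputs.towerHyps D hD hD4 hsq h7 : SemilocalUnitTower.Hyps 7 placeSeven (cyclotomicLayer (F₀ D) 7)
  (cyclotomicLayer_monotone (F₀ D) 7) (torsionCyclotomicSubgroup 7) γ₀` — the anonymous-constructor term
  `⟨normal_layer D, finiteDimensional_layer D, seven_mem_placeSeven, pow_fix_γ₀ D hD hD4 hsq h7, comm_fix_γ₀ D hD hD4 hsq,
  descends_layer D, continuous_layer D⟩` (pen D1099, certified in bsd-idea-20 g83's scratch `socketTest_g83.lean`);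
* **`genusFrameOf D hD hD4 hsq h7 N hN hNc hKL : GenusFrame`** `:= mkGenusFrame D hD hD4 hsq h7 N hN hNc hKL
  (cyclotomicSemilocalUnitData 7 placeSeven (cyclotomicLayer (F₀ D) 7) (cyclotomicLayer_monotone (F₀ D) 7)
  (torsionCyclotomicSubgroup 7) γ₀ ⟨…⟩)` — the socket line VERBATIM (g77 memo §4);
* the `rfl` readings `genusFrameOf_D/_normA/_v/_F₀/_u/_γ₀/_U` (consumers rewrite the frame's fields to K2C-14's closed
  terms: `F.v = placeSeven`, `F.F₀ = F₀ D`, `F.γ₀ = γ₀`, `F.U = cyclotomicSemilocalUnitData … (towerHyps …)`);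
* `nonempty_genusFrame hKL : Nonempty GenusFrame` — the INHABITATION record of the frame type modulo the ONE displayed
  named fact `hKL : iwasawa_existsUnique_kubotaLeopoldtSeries` (Iwasawa's construction of the Kubota–Leopoldt series,
  cited in `KubotaLeopoldtPowerSeries.lean`), at the sample road data `D = −11`, `N = 2`.

HONEST LABEL: a definition by assembly + `rfl` lemmas + one inhabitation record; the only undischarged input is the
displayed named fact `hKL`; nothing about elliptic units, Kato's classes or `L`-values is asserted; no `instance`, no
`notation`/`macro`, no named fact introduced, no attribute removed, no `sorry`; nothing closes;
stmt-BirchSwinnertonDyer-19945 is OPEN; `X12.CMRamifiedSeven` is NOT proved; no summit statement is proved by this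
seat; BSD is claimed for no curve.

## References
* [Tsuji1999] T. Tsuji, Semi-local units modulo cyclotomic units, J. Number Theory 78 (1999), §3 Thm. 3.1 (p. 6: the
  binders), §3 pp. 5–6 (`𝓤 = lim← 𝓤_{K_n}`).
* [Kato2004Asterisque] K. Kato, Astérisque 295 (2004), §15.5 (p. 253: the auxiliary ideal `𝔞`, `N(𝔞)` prime to `7|D|`).
* [Lang1990] S. Lang, Cyclotomic Fields I and II (1990), Appendix (Rubin) §8 (6), Ch. 7 §5 (the Kubota–Leopoldt series).
-/

noncomputable section

open scoped NumberField
open Field IsDedekindDomain NumberField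
open Literature.NumberTheory.IwasawaTheory
open Literature.NumberTheory.ComplexMultiplication.EllipticUnits

namespace Summit.BirchSwinnertonDyer.Rank1Residual.Additive.GenusSeven

namespace ArithmeticInputs

/-- **The tower hypotheses of the K2C-13 constructor HOLD at the socket** (`p = 7`, `v = placeSeven`,
`L = cyclotomicLayer (F₀ D) 7`, `Υ = torsionCyclotomicSubgroup 7`, `γ = γ₀`): the anonymous-constructor term of pen
D1099 from the seven discharges of `RamifiedSevenGenusCyclotomicTowerHyps.lean`. [cite: Tsuji1999, §3 (pp. 5–6)] -/
theorem towerHyps (D : ℤ) (hD : D < 0) (hD4 : D % 4 = 1) (hsq : Squarefree D) (h7 : ¬ (7 : ℤ) ∣ D) :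
    SemilocalUnitTower.Hyps 7 placeSeven (cyclotomicLayer (F₀ D) 7) (cyclotomicLayer_monotone (F₀ D) 7)
      (torsionCyclotomicSubgroup 7) γ₀ :=
  ⟨normal_layer D, finiteDimensional_layer D, seven_mem_placeSeven, pow_fix_γ₀ D hD hD4 hsq h7,
    comm_fix_γ₀ D hD hD4 hsq, descends_layer D, continuous_layer D⟩

end ArithmeticInputs

open ArithmeticInputs

set_option maxHeartbeats 1600000 in
/-- **File (6): the `𝒞₇` genus frame of the road data `(D, N)`** — `D < 0`, `D ≡ 1 (4)`, squarefree, `7 ∤ D`;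
`2 ≤ N` prime to `7|D|` — modulo the displayed Kubota–Leopoldt existence fact `hKL`: every arithmetic field by row
K2C-14's closed terms (`mkGenusFrame`), the semi-local datum `U` = Tsuji's `𝓤 = lim← 𝓤_{K_n}` of row K2C-13 at the
socket (the one line of the junction memo §4, pen D1099). [cite: Tsuji1999, §3 Thm 3.1 (p. 6) — the binders; §3 (pp. 5–6)]
[cite: Kato2004Asterisque, §15.5 (p. 253)] -/
def genusFrameOf (D : ℤ) (hD : D < 0) (hD4 : D % 4 = 1) (hsq : Squarefree D) (h7 : ¬ (7 : ℤ) ∣ D)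
    (N : ℕ) (hN : 2 ≤ N) (hNc : N.Coprime (7 * D.natAbs)) (hKL : iwasawa_existsUnique_kubotaLeopoldtSeries) :
    GenusFrame :=
  mkGenusFrame D hD hD4 hsq h7 N hN hNc hKL
    (cyclotomicSemilocalUnitData 7 placeSeven (cyclotomicLayer (F₀ D) 7) (cyclotomicLayer_monotone (F₀ D) 7)
      (torsionCyclotomicSubgroup 7) γ₀ ⟨normal_layer D, finiteDimensional_layer D, seven_mem_placeSeven,
        pow_fix_γ₀ D hD hD4 hsq h7, comm_fix_γ₀ D hD hD4 hsq, descends_layer D, continuous_layer D⟩)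

section Readings

variable (D : ℤ) (hD : D < 0) (hD4 : D % 4 = 1) (hsq : Squarefree D) (h7 : ¬ (7 : ℤ) ∣ D)
  (N : ℕ) (hN : 2 ≤ N) (hNc : N.Coprime (7 * D.natAbs)) (hKL : iwasawa_existsUnique_kubotaLeopoldtSeries)

/-- The frame's discriminant is `D`. [cite: Tsuji1999, §3 (p. 5)] -/
theorem genusFrameOf_D : (genusFrameOf D hD hD4 hsq h7 N hN hNc hKL).D = D := rfl

/-- The frame's `N𝔞` is `N`. [cite: Kato2004Asterisque, §15.5 (p. 253)] -/
theorem genusFrameOf_normA : (genusFrameOf D hD hD4 hsq h7 N hN hNc hKL).normA = N := rfl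

/-- The frame's place is `placeSeven`. [cite: Tsuji1999, §3 (p. 5)] -/
theorem genusFrameOf_v : (genusFrameOf D hD hD4 hsq h7 N hN hNc hKL).v = placeSeven := rfl

/-- The frame's `F₀` is `F₀ D = ℚ(√D)`. [cite: Tsuji1999, §3 (p. 5)] -/
theorem genusFrameOf_F₀ : (genusFrameOf D hD hD4 hsq h7 N hN hNc hKL).F₀ = F₀ D := rfl

/-- The frame's topological generator is K2C-14's `u` (`= 64`). [cite: Tsuji1999, §3 (p. 6)] -/
theorem genusFrameOf_u : (genusFrameOf D hD hD4 hsq h7 N hN hNc hKL).u = u := rfl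

/-- The frame's `γ₀` is K2C-14's `γ₀ = σ₈²`. [cite: Tsuji1999, §3 (p. 6)] -/
theorem genusFrameOf_γ₀ : (genusFrameOf D hD hD4 hsq h7 N hN hNc hKL).γ₀ = γ₀ := rfl

set_option maxHeartbeats 1600000 in
/-- **The frame's semi-local datum `U` is Tsuji's `𝓤` of row K2C-13 at the socket** (`rfl`).
[cite: Tsuji1999, §3 (pp. 5–6, «𝓤 = lim← 𝓤_{K_n}»)] -/
theorem genusFrameOf_U :
    (genusFrameOf D hD hD4 hsq h7 N hN hNc hKL).U =
      cyclotomicSemilocalUnitData 7 placeSeven (cyclotomicLayer (F₀ D) 7) (cyclotomicLayer_monotone (F₀ D) 7)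
        (torsionCyclotomicSubgroup 7) γ₀ (towerHyps D hD hD4 hsq h7) := rfl

end Readings

/-- Sample road data: `D = −11` is negative, `≡ 1 (mod 4)`, squarefree, prime to `7`; `N = 2` is prime to `77`.
[cite: Kato2004Asterisque, §15.5 (p. 253)] -/
theorem sampleRoadData :
    (-11 : ℤ) < 0 ∧ (-11 : ℤ) % 4 = 1 ∧ Squarefree (-11 : ℤ) ∧ ¬ (7 : ℤ) ∣ (-11) ∧ (2 : ℕ) ≤ 2 ∧
      (2 : ℕ).Coprime (7 * (-11 : ℤ).natAbs) := by
  refine ⟨by norm_num, by decide, ?_, by decide, le_rfl, by decide⟩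
  exact (Int.prime_iff_natAbs_prime.mpr (by norm_num)).squarefree

set_option maxHeartbeats 1600000 in
/-- **INHABITATION RECORD: the frame type `GenusSeven.GenusFrame` is inhabited modulo the single displayed named fact
`hKL : iwasawa_existsUnique_kubotaLeopoldtSeries`** (at the sample road data `D = −11`, `N = 2`).
[cite: Tsuji1999, §3 Thm 3.1 (p. 6)] [cite: Lang1990, Appendix §8 (6) (PDF p. 268)] -/
theorem nonempty_genusFrame (hKL : iwasawa_existsUnique_kubotaLeopoldtSeries) : Nonempty GenusFrame :=
  ⟨genusFrameOf (-11) sampleRoadData.1 sampleRoadData.2.1 sampleRoadData.2.2.1 sampleRoadData.2.2.2.1 2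
    sampleRoadData.2.2.2.2.1 sampleRoadData.2.2.2.2.2 hKL⟩

end Summit.BirchSwinnertonDyer.Rank1Residual.Additive.GenusSeven

end
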